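import Summits.CriticalPhenomena.PercolationContinuityZ3.Theorems.Transplant.BccSlabSqShadowCritical
import HarnessLib

/-!
# The bcc (001)-slabs, exit-form routing certificate I: the CLEARED SET `W = lift (block ∖ corner columns)` and the reduction of
# `ShapedLinkageX 3 (BccSlab.sqShadow k)` to a COLUMN-LEVEL routing statement

builds on p205010 (kernel theorem, internal audit signed; external expert review pending) — NOT used in this file.
Lane `prim-bschramm`, seat `prim-bschramm-p2` (gen 46; class C1b = films / other 3D lattices at their own critical point, METHOD = input
substitution; memo `HOME/bschramm/P2-LATTICES.md` §156); helper file (`--supports stmt-CriticalPhenomena-4575 --as helper`).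

WHY.  «BccSlabSqShadowCritical».`BccSlab.theta_criticalProb_eq_zero_of_shapedLinkageX` gives `θ_{S_k(bcc)}(p_c) = 0` (p205010-free, every `k ≥ 1`) from the
finite routing certificate `(BccSlab.sqShadow k).ShapedLinkageX R` of «SqShadowVRouteDataX», any `R ≥ 1`; the vertex node `LocalLinkage` is FALSE for the bcc
slabs («BccSlabNotLocalLinkage»: a corner vertex of extreme height is adjacent over the block only to two ring terminals), and the same obstruction
kills the exit form for the full lift of the block as cleared set.  THE CLEARED SET OF THE bcc CERTIFICATE (`R = 3`) is therefore the lift of the clipped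
block `sqBlkR 3 z t_D s_D` MINUS ITS FOUR CORNER COLUMNS (§1, `BccSlab.clearedSet`; it contains every vertex over `sqBall z 1 ∩ block` because under the
node's side condition `3 ≤ t_D ∨ 3 ≤ s_D` the corners are at sup-distance `3` from `z`).  With this `W` the terminal data `TerminalsX` certified by the
generic routing boil down to COLUMN conditions (§2–§3): the columns of `E₁, E₂, w'` are TARGET COLUMNS — cleared columns lattice-adjacent to an EXTERIOR
column (one in the exit window `{ξ ≤ ξ(z)+t_D, η ≤ η(z)+s_D}` but not cleared: outside the block, or a corner column) —, those of `E₁, E₂` lie in the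
rerouting block `sqBlkR 3 z t_R s_R` and are not `z`, and that of `w'` differs from both.  **`BccSlab.shapedLinkageX_of_colRouting`** (§3): a swap pair of
`VRouteData` for every such column-certified triple, every block pair, gives `ShapedLinkageX 3`; **`BccSlab.theta_criticalProb_eq_zero_of_colRouting`**.
The column-level statement `BccSlab.ColRouting k` is what the uniform 3D template discharges (hub claw + lifted planar legs «BccSlabLift» for the generic
column triples, decided by a kernel table over the `107 558` planar configurations of the `52` clip classes; an explicit 3D template for the one
exceptional family — `E₁, E₂` stacked in a column with only two usable neighbour columns one of which carries `w'`; design note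
`HOME/prim-bschramm-p2-g46/X-TEMPLATE.md`, oracles in the seat folder).
[cite: DuminilCopinSidoraviciusTassion2016, §2.3 (proof of Fact 2: the ball B̄_R(z), u', v', w' and the three disjoint paths)] [cite: ConwaySloane1999, Ch. 4 §7.1]
-/

noncomputable section

namespace Summit.CriticalPhenomena.PercolationContinuityZ3.Theorems.Transplant

namespace BccSlab

open MeasureTheory Literature.Probability.Percolation Literature.Probability.LatticeModels SimpleGraph
open scoped Classical

variable {k : ℕ}

/-! ## §1 The cleared set: the block minus its corner columns -/

/-- **The corner columns of the clipped block `sqBlkR 3 z t s`** (the rectangle `[z₀−3, z₀+min t 3] × [z₁−3, z₁+min s 3]`): both coordinates extreme.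
[cite: DuminilCopinSidoraviciusTassion2016, §2.3 (proof of Fact 2: the ball B̄_R(z))] -/
def cornerCols (z : Site 2) (t s : ℕ) : Set (Site 2) :=
  {w | (w 0 = z 0 - 3 ∨ w 0 = z 0 + min (t : ℤ) 3) ∧ (w 1 = z 1 - 3 ∨ w 1 = z 1 + min (s : ℤ) 3)}

/-- Membership in the corner columns. [folklore] -/
@[simp] theorem mem_cornerCols {z : Site 2} {t s : ℕ} {w : Site 2} :
    w ∈ cornerCols z t s ↔ (w 0 = z 0 - 3 ∨ w 0 = z 0 + min (t : ℤ) 3) ∧ (w 1 = z 1 - 3 ∨ w 1 = z 1 + min (s : ℤ) 3) := Iff.rfl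

/-- **The cleared columns**: the clipped block of radius `3` minus its corner columns. [cite: DuminilCopinSidoraviciusTassion2016, §2.3 (proof of Fact 2)] -/
def Dcols (z : Site 2) (t s : ℕ) : Set (Site 2) := {w | w ∈ sqBlkR 3 z t s ∧ w ∉ cornerCols z t s}

/-- Membership in the cleared columns. [folklore] -/
theorem mem_Dcols {z : Site 2} {t s : ℕ} {w : Site 2} : w ∈ Dcols z t s ↔ w ∈ sqBlkR 3 z t s ∧ w ∉ cornerCols z t s := Iff.rfl

/-- Membership in the clipped block of radius `3`, `abs`-free. [folklore] -/
theorem mem_sqBlkR_three_iff_linear {z : Site 2} {t s : ℕ} {w : Site 2} :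
    w ∈ sqBlkR 3 z t s ↔ (z 0 - 3 ≤ w 0 ∧ w 0 ≤ z 0 + 3 ∧ z 1 - 3 ≤ w 1 ∧ w 1 ≤ z 1 + 3) ∧ w 0 ≤ z 0 + t ∧ w 1 ≤ z 1 + s := by
  rw [mem_sqBlkR, mem_sqBall_iff_linear]; norm_num

/-- The cleared columns lie in the block. [folklore] -/
theorem Dcols_subset (z : Site 2) (t s : ℕ) : Dcols z t s ⊆ sqBlkR 3 z t s := fun _ h => h.1

/-- **Under the node's side condition the corner columns are far from the centre**: a column of `sqBall z 1` in the block is cleared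
(`3 ≤ t ∨ 3 ≤ s`: the block is clipped in at most one direction, so every corner has a coordinate at distance `3`). [folklore] -/
theorem mem_Dcols_of_sqBall_one {z : Site 2} {t s : ℕ} (hts : 3 ≤ t ∨ 3 ≤ s) {w : Site 2} (h1 : w ∈ sqBall z 1) (hB : w ∈ sqBlkR 3 z t s) :
    w ∈ Dcols z t s := by
  refine ⟨hB, fun hc => ?_⟩
  rw [mem_sqBall_iff_linear] at h1
  obtain ⟨h0, h1'⟩ := (mem_cornerCols.1 hc)
  rcases hts with ht | hs
  · have hmin : min (t : ℤ) 3 = 3 := min_eq_right (by exact_mod_cast ht)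
    rw [hmin] at h0
    push_cast at h1
    omega
  · have hmin : min (s : ℤ) 3 = 3 := min_eq_right (by exact_mod_cast hs)
    rw [hmin] at h1'
    push_cast at h1
    omega

/-- **THE CLEARED SET of the bcc certificate**: all slab vertices over the cleared columns (every height).
[cite: DuminilCopinSidoraviciusTassion2016, §2.3 (proof of Fact 2: the ball B̄_R(z))] -/
def clearedSet (k : ℕ) (z : Site 2) (t s : ℕ) : Set (bslab k) := {x | sh x ∈ Dcols z t s}

/-- Membership in the cleared set is a column condition. [folklore] -/
@[simp] theorem mem_clearedSet {z : Site 2} {t s : ℕ} {x : bslab k} : x ∈ clearedSet k z t s ↔ sh x ∈ Dcols z t s := Iff.rfl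

/-- The cleared set is the lift of the cleared columns. [folklore] -/
theorem clearedSet_eq_lift (k : ℕ) (z : Site 2) (t s : ℕ) : clearedSet k z t s = (sqShadow k).lift (Dcols z t s) := rfl

/-- The cleared set lies over the block (first sandwich condition of the node). [folklore] -/
theorem sh_mem_sqBlkR_of_mem_clearedSet {z : Site 2} {t s : ℕ} : ∀ x ∈ clearedSet k z t s, (sqShadow k).sh x ∈ sqBlkR 3 z t s :=
  fun _ hx => hx.1

/-- The cleared set contains every vertex over `sqBall z 1 ∩ block` (second sandwich condition of the node). [folklore] -/
theorem mem_clearedSet_of_sqBall_one {z : Site 2} {t s : ℕ} (hts : 3 ≤ t ∨ 3 ≤ s) :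
    ∀ x : bslab k, (sqShadow k).sh x ∈ sqBall z 1 → (sqShadow k).sh x ∈ sqBlkR 3 z t s → x ∈ clearedSet k z t s :=
  fun _ h1 hB => mem_Dcols_of_sqBall_one hts h1 hB

/-! ## §2 Exterior columns and target columns -/

/-- **The exterior columns**: in the exit window `{ξ ≤ ξ(z) + t_D} ∩ {η ≤ η(z) + s_D}` but not cleared (outside the block, or a corner column) — where the
vertices `o₁, o₂ ∉ W` next to the terminals and the exit neighbour `x ∉ W` of `w'` live. [cite: DuminilCopinSidoraviciusTassion2016, §2.3 (proof of Fact 2: the path π leaving B̄_R(z))] -/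
def extCols (z : Site 2) (t s : ℕ) : Set (Site 2) := {q | SqShadow.InWin z t s q ∧ q ∉ Dcols z t s}

/-- Membership in the exterior columns. [folklore] -/
@[simp] theorem mem_extCols {z : Site 2} {t s : ℕ} {q : Site 2} : q ∈ extCols z t s ↔ SqShadow.InWin z t s q ∧ q ∉ Dcols z t s := Iff.rfl

/-- **The target columns**: cleared columns lattice-adjacent to an exterior column (the possible columns of `E₁, E₂, w'`). [folklore] -/
def tgtCols (z : Site 2) (t s : ℕ) : Set (Site 2) := {q | q ∈ Dcols z t s ∧ ∃ q' : Site 2, (zdGraph 2).Adj q q' ∧ q' ∈ extCols z t s}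

/-- Membership in the target columns. [folklore] -/
@[simp] theorem mem_tgtCols {z : Site 2} {t s : ℕ} {q : Site 2} :
    q ∈ tgtCols z t s ↔ q ∈ Dcols z t s ∧ ∃ q' : Site 2, (zdGraph 2).Adj q q' ∧ q' ∈ extCols z t s := Iff.rfl

/-- The window is monotone in its second parameter. [folklore] -/
theorem inWin_mono {z : Site 2} {t s s' : ℕ} (h : s ≤ s') {q : Site 2} (hq : SqShadow.InWin z t s q) : SqShadow.InWin z t s' q := by
  obtain ⟨h0, h1⟩ := hq
  have hs : (s : ℤ) ≤ s' := by exact_mod_cast h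
  exact ⟨h0, by omega⟩

/-- **A cleared vertex with a non-cleared slab neighbour over the window sits over a target column.** [folklore] -/
theorem tgtCol_of_adj {z : Site 2} {t s : ℕ} {x o : bslab k} (hx : x ∈ clearedSet k z t s) (hadj : (slabGraph k).Adj x o)
    (ho : o ∉ clearedSet k z t s) (hwin : SqShadow.InWin z t s (sh o)) : sh x ∈ tgtCols z t s :=
  ⟨hx, sh o, sh_step hadj, hwin, ho⟩

/-! ## §3 The column-level routing statement and the reduction -/

/-- **COLUMN-LEVEL ROUTING for `S_k(bcc)`** (what the 3D template discharges): for every centre `z` and block pair `sqBlkR 3 z t_R s_R ⊆ sqBlkR 3 z t_D s_D`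
clipped in at most one direction, all slab vertices `E₁ ≠ E₂` over target columns of the rerouting block other than `z`, and `w'` over a target column
different from theirs, there is a SWAP PAIR of `VRouteData` with rerouted piece in `W ∩ lift (sqBlkR 3 z t_R s_R)` and branch in `W = clearedSet k z t_D s_D`.
An internal obligation, never asserted. [cite: DuminilCopinSidoraviciusTassion2016, §2.3 (proof of Fact 2: the three disjoint paths in B̄_R(z))] -/
def ColRouting (k : ℕ) : Prop :=
  ∀ (z : Site 2) (tR tD sR sD : ℕ), tR ≤ tD → sR ≤ sD → (3 ≤ tR ∨ 3 ≤ sR) →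
    ∀ (E₁ E₂ w' : bslab k), E₁ ≠ E₂ →
      sh E₁ ∈ tgtCols z tD sD → sh E₁ ∈ sqBlkR 3 z tR sR → sh E₁ ≠ z →
      sh E₂ ∈ tgtCols z tD sD → sh E₂ ∈ sqBlkR 3 z tR sR → sh E₂ ≠ z →
      sh w' ∈ tgtCols z tD sD → sh w' ≠ sh E₁ → sh w' ≠ sh E₂ →
        ∃ r₁ r₂ : VRouteData (slabGraph k) (clearedSet k z tD sD ∩ (sqShadow k).lift (sqBlkR 3 z tR sR)) (clearedSet k z tD sD) E₁ E₂ w',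
          r₁.y = r₂.b ∧ r₁.b = r₂.y

/-- **REDUCTION: column-level routing gives the exit-form certificate `ShapedLinkageX 3` with the cleared set `W = lift (block ∖ corners)`.**
The terminal data `TerminalsX 3 z t_R t_D s_R s_D W E₁ E₂ w'` supply: `E₁ ≠ E₂` in `W` over `sqBlkR 3 z t_R s_R`, not over `z`, each with a neighbour `oᵢ ∉ W`
over the `γ`-window `{ξ ≤ ξ(z)+t_D, η ≤ η(z)+s_R} ⊆` exit window — so over target columns —; `w' ∈ W` off their columns with an exit neighbour `x ∉ W` over
the exit window — a target column too. [cite: DuminilCopinSidoraviciusTassion2016, §2.3 (proof of Fact 2)] -/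
theorem shapedLinkageX_of_colRouting (H : ColRouting k) : (sqShadow k).ShapedLinkageX 3 := by
  intro z tR tD sR sD htRD hsRD hone
  have hts : 3 ≤ tD ∨ 3 ≤ sD := hone.imp (fun h => h.trans htRD) (fun h => h.trans hsRD)
  refine ⟨clearedSet k z tD sD, sh_mem_sqBlkR_of_mem_clearedSet, mem_clearedSet_of_sqBall_one hts, fun E₁ E₂ w' hT => ?_⟩
  obtain ⟨o₁, a₁, a₂, o₂, ho₁, -, -, ho₂, ho₁W, ho₂W, hwo₁, -, -, hwo₂, -⟩ := hT.nbrs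
  obtain ⟨x, hx, hxW, hxwin, -, -, -⟩ := hT.w'x
  have hT₁ : sh E₁ ∈ tgtCols z tD sD := tgtCol_of_adj hT.E₁W ho₁.symm ho₁W (inWin_mono hsRD hwo₁)
  have hT₂ : sh E₂ ∈ tgtCols z tD sD := tgtCol_of_adj hT.E₂W ho₂ ho₂W (inWin_mono hsRD hwo₂)
  have hT₃ : sh w' ∈ tgtCols z tD sD := tgtCol_of_adj hT.w'W hx hxW hxwin
  exact H z tR tD sR sD htRD hsRD hone E₁ E₂ w' hT.ne hT₁ hT.E₁R hT.E₁z hT₂ hT.E₂R hT.E₂z hT₃ hT.w'E₁ hT.w'E₂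

/-- **`θ_{S_k(bcc)}(v, p_c(S_k(bcc))) = 0` FROM COLUMN-LEVEL ROUTING**, every `k ≥ 1` — p205010-free (the square DST layer «SqShadow*» with the thin-instance
routing «SqShadowVRoutingX», the cleared set of §1). [cite: DuminilCopinSidoraviciusTassion2016, Thm. 1 and §2.3] [cite: BenjaminiSchramm1996, Conj. 4 / Question 3] -/
theorem theta_criticalProb_eq_zero_of_colRouting (hk : 1 ≤ k) (H : ColRouting k) (v : bslab k) :
    theta (slabGraph k) v (criticalProbIOf (slabGraph k) v) = 0 :=
  theta_criticalProb_eq_zero_of_shapedLinkageX hk (by norm_num : (1 : ℕ) ≤ 3) (shapedLinkageX_of_colRouting H) v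

end BccSlab

end Summit.CriticalPhenomena.PercolationContinuityZ3.Theorems.Transplant

end
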